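/-
HONEST FRAMING: certified error envelopes and provably optimal rounding/accumulation schemes for
low-precision formats under stated cost models; every table by two implementations; no hardware
or vendor claims.
-/
import Mathlib.Data.Rat.Floor
import Summits.Ventures.CertifiedArithmetic.LowPrec.OptDemotionRoutingDescent
import Summits.Ventures.CertifiedArithmetic.LowPrec.OptDemotionRoutingLRL

/-!
# The demotion law (Theorem T8), part 8n: CONJECTURE D FOR EVERY TREE FROM opt's TWO-TREE INEQUALITY (TT)

The last link of opt gen 13's reduction (R20) in Lean: `TT q → LRL q` (`LRL_of_TT`), hence
`TT q →` the routing conjecture for every shape (`routingBound_of_TT`) and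
**`TT q →` CONJECTURE D `s ≤ Q_t · fl_p(ŝ)` FOR EVERY SUMMATION TREE** at precision `q ≥ 2`, every
`p ≥ 1`, any nearest roundings, nonnegative data (`conjectureD_of_TT`).  The step proved here is the
RAISE: an admissible pair of child configurations (`val A, val B ≤ m`, `val A + val B ≤ m + ½`) is
dominated, by monotonicity (M) (part 8i), by a TOP PAIR `(n + ½ | m - n)` of part 8m (case analysis
on whether each value is an integer, an odd half-integer, or has a bit below `¼`, in which case it
is at most `2^(q-2) - ¼`), and top pairs are dominated by bit partitions by the descent of part 8m.
So the position of Conjecture D (OPTIMA.md §B T8(b)(iii)) in Lean is exactly opt's: everything is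
proved except the single boxed two-tree inequality `TT q` (part 8l), certified on 15 063 208 exact
instances (C33) and open.
-/

namespace Summit.Ventures.CertifiedArithmetic.LowPrec.Opt

open Literature.ComputerArithmetic.JeannerodRump2018
open Literature.ComputerArithmetic.JeannerodRump2018.SumTree

section Raise

variable {q : ℕ}

/-- A routable nonempty configuration is a float of its value. -/
theorem isQFloat_val {A : Finset ℤ} (hne : A.Nonempty) (hA : Routable q A) : IsQFloat q (val A) :=
  ⟨A, hne, hA, rfl⟩

/-- Domination of a child configuration by a float of larger value ((M), or `0 ≤ BR`). -/
theorem treeBR_le_treeBRv (hq : 1 ≤ q) (t : SumTree) {A : Finset ℤ} (hA : Routable q A) {z : ℚ}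
    (hz : IsQFloat q z) (hle : val A ≤ z) : treeBR q t A ≤ treeBRv q t z := by
  by_cases hne : A.Nonempty
  · rw [← treeBRv_val]; exact treeBRv_mono hq t (isQFloat_val hne hA) hz hle
  · rw [Finset.not_nonempty_iff_eq_empty.1 hne, treeBR, treeBRw_empty]; exact treeBRv_nonneg q t z

/-- A `q`-bit float below `2^t` is at most `2^t - 2^(t-q)` (the float grid below a power of two). -/
theorem isQFloat_le_sub_of_lt {x : ℚ} (hx : IsQFloat q x) {t : ℤ} (hlt : x < (2 : ℚ) ^ t) :
    x ≤ (2 : ℚ) ^ t - (2 : ℚ) ^ (t - q) := by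
  obtain ⟨hne, hS, hv⟩ := hx.bitsOf
  set S := bitsOf x with hSdef
  -- top below t
  have htop : S.max' hne ≤ t - 1 := by
    by_contra h
    have h : t ≤ S.max' hne := by omega
    have := two_zpow_le_val hne
    have : (2 : ℚ) ^ t ≤ (2 : ℚ) ^ (S.max' hne) := zpow_le_zpow_right₀ (by norm_num) h
    linarith
  -- all bits ≥ max - q + 1 =: ℓ, so x = N 2^ℓ with N < 2^q
  set ℓ := S.max' hne - q + 1 with hℓ
  have hSℓ : ∀ e ∈ S, ℓ ≤ e := fun e he => by
    have := hS (S.max' hne) (Finset.max'_mem S hne) e he; rw [hℓ]; linarith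
  obtain ⟨N, hN⟩ := val_eq_nat_mul hSℓ
  have hlt2 : val S < 2 * (2 : ℚ) ^ (S.max' hne) := val_lt_two_zpow S hne
  have hpos : (0 : ℚ) < (2 : ℚ) ^ ℓ := zpow_pos (by norm_num) _
  have e1 : 2 * (2 : ℚ) ^ (S.max' hne) = (2 : ℚ) ^ (q : ℤ) * (2 : ℚ) ^ ℓ := by
    rw [← zpow_one_add₀ (two_ne_zero), ← zpow_add₀ (two_ne_zero)]; congr 1; rw [hℓ]; ring
  rw [hN, e1] at hlt2
  have hNlt : (N : ℚ) < (2 : ℚ) ^ (q : ℤ) := lt_of_mul_lt_mul_right hlt2 hpos.le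
  have hNle : (N : ℚ) ≤ (2 : ℚ) ^ (q : ℤ) - 1 := by
    have : (N : ℚ) < ((2 ^ q : ℕ) : ℚ) := by rw [zpow_natCast] at hNlt; exact_mod_cast hNlt
    have : N < 2 ^ q := by exact_mod_cast this
    have : N ≤ 2 ^ q - 1 := by omega
    have : (N : ℚ) ≤ ((2 ^ q - 1 : ℕ) : ℚ) := by exact_mod_cast this
    rw [Nat.cast_sub Nat.one_le_two_pow] at this; push_cast at this
    rw [zpow_natCast]; exact this
  -- x = N 2^ℓ ≤ (2^q - 1) 2^ℓ = 2^(max+1) - 2^ℓ ≤ 2^t - 2^(t-q)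
  have e2 : ((2 : ℚ) ^ (q : ℤ) - 1) * (2 : ℚ) ^ ℓ = (2 : ℚ) ^ (S.max' hne + 1) - (2 : ℚ) ^ ℓ := by
    rw [sub_mul, ← zpow_add₀ (two_ne_zero), one_mul]; congr 2; rw [hℓ]; ring
  have h3 : (2 : ℚ) ^ (S.max' hne + 1) - (2 : ℚ) ^ ℓ ≤ (2 : ℚ) ^ t - (2 : ℚ) ^ (t - q) := by
    -- both are (2^q - 1) 2^(·) with exponents ℓ ≤ t - q
    have e3 : (2 : ℚ) ^ t - (2 : ℚ) ^ (t - q) = ((2 : ℚ) ^ (q : ℤ) - 1) * (2 : ℚ) ^ (t - q) := by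
      rw [sub_mul, ← zpow_add₀ (two_ne_zero), one_mul]; congr 2; ring
    rw [← e2, e3]
    have hq1 : (1 : ℚ) ≤ (2 : ℚ) ^ (q : ℤ) := one_le_zpow₀ (by norm_num) (by positivity)
    exact mul_le_mul_of_nonneg_left (zpow_le_zpow_right₀ (by norm_num) (by rw [hℓ]; omega)) (by linarith)
  calc x = val S := hv.symm
    _ = N * (2 : ℚ) ^ ℓ := hN
    _ ≤ ((2 : ℚ) ^ (q : ℤ) - 1) * (2 : ℚ) ^ ℓ := mul_le_mul_of_nonneg_right hNle hpos.le
    _ = (2 : ℚ) ^ (S.max' hne + 1) - (2 : ℚ) ^ ℓ := e2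
    _ ≤ (2 : ℚ) ^ t - (2 : ℚ) ^ (t - q) := h3

/-- TRICHOTOMY for a `q`-bit float: an integer, an odd half-integer, or (a bit below `¼`, hence the
top at most `q - 3`) at most `2^(q-2) - ¼`. -/
theorem isQFloat_trichotomy {x : ℚ} (hx : IsQFloat q x) :
    (∃ N : ℕ, x = N) ∨ (∃ N : ℕ, x = N + 1 / 2) ∨ x ≤ (2 : ℚ) ^ ((q : ℤ) - 2) - 1 / 4 := by
  obtain ⟨hne, hS, hv⟩ := hx.bitsOf
  set S := bitsOf x with hSdef
  by_cases hlow : ∃ e ∈ S, e ≤ -2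
  · -- a bit below ¼: the top is ≤ q - 3, so x < 2^(q-2), so x ≤ 2^(q-2) - 2^(-2)
    right; right
    obtain ⟨e, he, he2⟩ := hlow
    have hmax : S.max' hne ≤ (q : ℤ) - 3 := by
      have := hS (S.max' hne) (Finset.max'_mem S hne) e he; linarith
    have hx2 : x < (2 : ℚ) ^ ((q : ℤ) - 2) := by
      have h1 := val_lt_two_zpow S hne
      have h2 : 2 * (2 : ℚ) ^ (S.max' hne) ≤ (2 : ℚ) ^ ((q : ℤ) - 2) := by
        rw [← zpow_one_add₀ (two_ne_zero)]
        exact zpow_le_zpow_right₀ (by norm_num) (by omega)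
      rw [hv] at h1; linarith
    have := isQFloat_le_sub_of_lt hx hx2
    rw [show (q : ℤ) - 2 - q = -2 by ring] at this
    have e4 : (2 : ℚ) ^ (-2 : ℤ) = 1 / 4 := by norm_num
    rw [e4] at this; exact this
  · have hge : ∀ e ∈ S, -1 ≤ e := fun e he => by
      by_contra h; exact hlow ⟨e, he, by omega⟩
    by_cases hhalf : (-1 : ℤ) ∈ S
    · right; left
      have hge0 : ∀ e ∈ S.erase (-1), (0 : ℤ) ≤ e := fun e he => by
        obtain ⟨hne1, heS⟩ := Finset.mem_erase.1 he
        have := hge e heS; omega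
      obtain ⟨N, hN⟩ := val_eq_nat_mul hge0
      refine ⟨N, ?_⟩
      have := val_eq_add_erase hhalf
      rw [hv, hN, zpow_zero, mul_one, zpow_neg, zpow_one] at this
      rw [this]; ring
    · left
      have hge0 : ∀ e ∈ S, (0 : ℤ) ≤ e := fun e he => by
        have := hge e he
        rcases eq_or_lt_of_le this with h | h
        · exact absurd (h ▸ he) hhalf
        · omega
      obtain ⟨N, hN⟩ := val_eq_nat_mul hge0
      exact ⟨N, by rw [← hv, hN, zpow_zero, mul_one]⟩

/-- **opt's LOCAL ROUTING LEMMA FROM (TT)** (`q ≥ 2`): every admissible pair of child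
configurations is dominated by the best bit partition of `bits m ∪ {-1}`. -/
theorem LRL_of_TT (hq : 2 ≤ q) (hTT : TT q) : LRL q := by
  intro a b m hm hm' A B hA hB hxm hym hsum
  have hq1 : 1 ≤ q := le_trans (by norm_num) hq
  set x := val A with hxdef
  set y := val B with hydef
  set H : ℚ := (2 : ℚ) ^ ((q : ℤ) - 1) with hHdef
  have hHnat : ((2 ^ (q - 1) : ℕ) : ℚ) = H := by rw [hHdef]; push_cast; exact two_pow_pred hq1
  have hHm : H ≤ m := by rw [← hHnat]; exact_mod_cast hm
  have hm1 : 1 ≤ m := le_trans Nat.one_le_two_pow hm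
  have hhalf : 2 ^ (q - 1) + 2 ^ (q - 1) = 2 ^ q := (two_pow_eq_half_add_half hq1).symm
  -- the descent: every top pair is good, both orientations
  have G : ∀ n : ℕ, n < 2 ^ (q - 1) → n ≤ m →
      H + treeBRv q a ((n : ℚ) + 1 / 2) + treeBRv q b ((m - n : ℕ) : ℚ) ≤ treeBR q (.node a b) (natBits m) ∧
      H + treeBRv q b ((n : ℚ) + 1 / 2) + treeBRv q a ((m - n : ℕ) : ℚ) ≤ treeBR q (.node a b) (natBits m) := by
    intro n hn hnm
    have h := topGood_of_TT hq hTT a b hm hm' _ n hn hnm le_rfl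
    unfold TopGood at h
    have hcomm : treeBR q (.node b a) (natBits m) = treeBR q (.node a b) (natBits m) := by
      unfold treeBR; exact treeBRw_node_comm q _ b a _
    rw [hcomm] at h
    exact h
  -- dominations
  have domA : ∀ z : ℚ, IsQFloat q z → x ≤ z → treeBR q a A ≤ treeBRv q a z :=
    fun z hz hle => treeBR_le_treeBRv hq1 a hA hz hle
  have domB : ∀ z : ℚ, IsQFloat q z → y ≤ z → treeBR q b B ≤ treeBRv q b z :=
    fun z hz hle => treeBR_le_treeBRv hq1 b hB hz hle
  have hx0 : 0 ≤ x := val_nonneg A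
  have hy0 : 0 ≤ y := val_nonneg B
  -- useful floats
  have Fhalf : ∀ n : ℕ, n < 2 ^ (q - 1) → IsQFloat q ((n : ℚ) + 1 / 2) := fun n hn => isQFloat_half hq1 hn
  have Fnat : ∀ n : ℕ, 1 ≤ n → n ≤ m → IsQFloat q (n : ℚ) := fun n h1 h2 =>
    isQFloat_natCast h1 (by omega)
  ------------------------------------------------------------------ (i) x ≤ ½ : partition (½ | m)
  by_cases hxs : x ≤ 1 / 2
  · have h := (G 0 (Nat.two_pow_pos _) (Nat.zero_le _)).1
    simp only [Nat.cast_zero, zero_add, Nat.sub_zero] at h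
    have h1 := domA (1 / 2) (by have := Fhalf 0 (Nat.two_pow_pos _); simpa using this) hxs
    have h2 := domB m (Fnat m hm1 le_rfl) hym
    linarith
  ------------------------------------------------------------------ (ii) y ≤ ½ : partition (m | ½)
  by_cases hys : y ≤ 1 / 2
  · have h := (G 0 (Nat.two_pow_pos _) (Nat.zero_le _)).2
    simp only [Nat.cast_zero, zero_add, Nat.sub_zero] at h
    have h1 := domB (1 / 2) (by have := Fhalf 0 (Nat.two_pow_pos _); simpa using this) hys
    have h2 := domA m (Fnat m hm1 le_rfl) hxm
    linarith
  have hxs : 1 / 2 < x := not_le.1 hxs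
  have hys : 1 / 2 < y := not_le.1 hys
  have hAne : A.Nonempty := by
    by_contra h; rw [Finset.not_nonempty_iff_eq_empty] at h
    rw [hxdef, h, val_empty] at hxs; linarith
  have hBne : B.Nonempty := by
    by_contra h; rw [Finset.not_nonempty_iff_eq_empty] at h
    rw [hydef, h, val_empty] at hys; linarith
  have hxF : IsQFloat q x := isQFloat_val hAne hA
  have hyF : IsQFloat q y := isQFloat_val hBne hB
  ------------------------------------------------------------------ (iii) x ≥ σ : x = N integer, b-odd top pair n = m - N
  by_cases hxH : H ≤ x
  · -- x is an integer N with 2^(q-1) ≤ N ≤ m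
    obtain ⟨hne, hS, hv⟩ := hxF.bitsOf
    have hge0 : ∀ e ∈ bitsOf x, (0 : ℤ) ≤ e := by
      intro e he
      have htop : (q : ℤ) - 1 ≤ (bitsOf x).max' hne := by
        by_contra h
        have h1 := val_lt_two_zpow (bitsOf x) hne
        have h2 : 2 * (2 : ℚ) ^ ((bitsOf x).max' hne) ≤ H := by
          rw [hHdef, ← zpow_one_add₀ (two_ne_zero)]; exact zpow_le_zpow_right₀ (by norm_num) (by omega)
        rw [hv] at h1; linarith
      have := hS _ (Finset.max'_mem _ hne) e he; linarith
    obtain ⟨N, hN⟩ := val_eq_nat_mul hge0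
    rw [hv, zpow_zero, mul_one] at hN
    have hNm : N ≤ m := by have : (N : ℚ) ≤ m := hN ▸ hxm; exact_mod_cast this
    have hNH : 2 ^ (q - 1) ≤ N := by
      have : H ≤ N := hN ▸ hxH; rw [← hHnat] at this; exact_mod_cast this
    set n := m - N with hn
    have hnlt : n < 2 ^ (q - 1) := by omega
    have h := (G n hnlt (Nat.sub_le m N)).2
    have hmn : m - n = N := by omega
    rw [hmn] at h
    have h1 := domB ((n : ℚ) + 1 / 2) (Fhalf n hnlt) (by rw [hn]; push_cast [Nat.cast_sub hNm]; linarith)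
    have h2 := domA (N : ℚ) (Fnat N (le_trans Nat.one_le_two_pow hNH) hNm) (le_of_eq hN)
    linarith
  ------------------------------------------------------------------ (iv) y ≥ σ : symmetric, a-odd n = m - N
  by_cases hyH : H ≤ y
  · obtain ⟨hne, hS, hv⟩ := hyF.bitsOf
    have hge0 : ∀ e ∈ bitsOf y, (0 : ℤ) ≤ e := by
      intro e he
      have htop : (q : ℤ) - 1 ≤ (bitsOf y).max' hne := by
        by_contra h
        have h1 := val_lt_two_zpow (bitsOf y) hne
        have h2 : 2 * (2 : ℚ) ^ ((bitsOf y).max' hne) ≤ H := by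
          rw [hHdef, ← zpow_one_add₀ (two_ne_zero)]; exact zpow_le_zpow_right₀ (by norm_num) (by omega)
        rw [hv] at h1; linarith
      have := hS _ (Finset.max'_mem _ hne) e he; linarith
    obtain ⟨N, hN⟩ := val_eq_nat_mul hge0
    rw [hv, zpow_zero, mul_one] at hN
    have hNm : N ≤ m := by have : (N : ℚ) ≤ m := hN ▸ hym; exact_mod_cast this
    have hNH : 2 ^ (q - 1) ≤ N := by
      have : H ≤ N := hN ▸ hyH; rw [← hHnat] at this; exact_mod_cast this
    set n := m - N with hn
    have hnlt : n < 2 ^ (q - 1) := by omega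
    have h := (G n hnlt (Nat.sub_le m N)).1
    have hmn : m - n = N := by omega
    rw [hmn] at h
    have h1 := domA ((n : ℚ) + 1 / 2) (Fhalf n hnlt) (by rw [hn]; push_cast [Nat.cast_sub hNm]; linarith)
    have h2 := domB (N : ℚ) (Fnat N (le_trans Nat.one_le_two_pow hNH) hNm) (le_of_eq hN)
    linarith
  have hxH : x < H := not_le.1 hxH
  have hyH : y < H := not_le.1 hyH
  ------------------------------------------------------------------ (v) both in (½, σ): trichotomy
  have hHq : H = ((2 ^ (q - 1) : ℕ) : ℚ) := hHnat.symm
  -- generic closers for the two orientations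
  have closeA : ∀ n : ℕ, n < 2 ^ (q - 1) → n ≤ m → x ≤ (n : ℚ) + 1 / 2 → y ≤ ((m - n : ℕ) : ℚ) →
      H + treeBR q a A + treeBR q b B ≤ treeBR q (.node a b) (natBits m) := by
    intro n hn hnm hxa hyb
    have h := (G n hn hnm).1
    have h1 := domA _ (Fhalf n hn) hxa
    have h2 := domB _ (Fnat (m - n) (by
      by_contra h0; push_cast [Nat.cast_sub hnm] at hyb
      have : m - n = 0 := by omega
      have : (m : ℚ) - n ≤ 0 := by
        have : (m : ℚ) ≤ n := by exact_mod_cast (Nat.sub_eq_zero_iff_le.1 this)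
        linarith
      linarith) (Nat.sub_le m n)) hyb
    linarith
  have closeB : ∀ n : ℕ, n < 2 ^ (q - 1) → n ≤ m → y ≤ (n : ℚ) + 1 / 2 → x ≤ ((m - n : ℕ) : ℚ) →
      H + treeBR q a A + treeBR q b B ≤ treeBR q (.node a b) (natBits m) := by
    intro n hn hnm hyb hxa
    have h := (G n hn hnm).2
    have h1 := domB _ (Fhalf n hn) hyb
    have h2 := domA _ (Fnat (m - n) (by
      by_contra h0; push_cast [Nat.cast_sub hnm] at hxa
      have : m - n = 0 := by omega
      have : (m : ℚ) - n ≤ 0 := by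
        have : (m : ℚ) ≤ n := by exact_mod_cast (Nat.sub_eq_zero_iff_le.1 this)
        linarith
      linarith) (Nat.sub_le m n)) hxa
    linarith
  show H + treeBR q a A + treeBR q b B ≤ treeBR q (.node a b) (natBits m)
  rcases isQFloat_trichotomy hxF with ⟨N, hN⟩ | ⟨N, hN⟩ | hxoff
  · ---- x = N integer (1 ≤ N < 2^(q-1))
    have hNlt : N < 2 ^ (q - 1) := by
      have : (N : ℚ) < ((2 ^ (q - 1) : ℕ) : ℚ) := by rw [← hHq, ← hN]; exact hxH
      exact_mod_cast this
    have hNm : N ≤ m := by have : (N : ℚ) ≤ m := hN ▸ hxm; exact_mod_cast this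
    by_cases hyN : y ≤ ((m - N : ℕ) : ℚ)
    · -- a-odd with n = N
      exact closeA N hNlt hNm (by rw [hN]; linarith) hyN
    · -- b-odd with n = m - N (then n < y < σ)
      have hyN := not_le.1 hyN
      have hnlt : m - N < 2 ^ (q - 1) := by
        have : ((m - N : ℕ) : ℚ) < ((2 ^ (q - 1) : ℕ) : ℚ) := by rw [← hHq]; linarith
        exact_mod_cast this
      refine closeB (m - N) hnlt (Nat.sub_le m N) ?_ ?_
      · push_cast [Nat.cast_sub hNm]; linarith
      · rw [show m - (m - N) = N by omega, hN]
  · ---- x = N + ½ odd half-integer: a-odd with n = N (o = x exactly)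
    have hNlt : N < 2 ^ (q - 1) := by
      have : (N : ℚ) < ((2 ^ (q - 1) : ℕ) : ℚ) := by rw [← hHq]; linarith
      exact_mod_cast this
    have hNm : N ≤ m := by
      have : (N : ℚ) ≤ m := by linarith
      exact_mod_cast this
    exact closeA N hNlt hNm (le_of_eq hN) (by push_cast [Nat.cast_sub hNm]; linarith)
  · ---- x has a bit below ¼, so x ≤ 2^(q-2) - ¼; trichotomy on y
    rcases isQFloat_trichotomy hyF with ⟨N, hN⟩ | ⟨N, hN⟩ | hyoff
    · -- y = N integer
      have hNlt : N < 2 ^ (q - 1) := by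
        have : (N : ℚ) < ((2 ^ (q - 1) : ℕ) : ℚ) := by rw [← hHq, ← hN]; exact hyH
        exact_mod_cast this
      have hNm : N ≤ m := by have : (N : ℚ) ≤ m := hN ▸ hym; exact_mod_cast this
      by_cases hxN : x ≤ ((m - N : ℕ) : ℚ)
      · exact closeB N hNlt hNm (by rw [hN]; linarith) hxN
      · have hxN := not_le.1 hxN
        have hnlt : m - N < 2 ^ (q - 1) := by
          have : ((m - N : ℕ) : ℚ) < ((2 ^ (q - 1) : ℕ) : ℚ) := by rw [← hHq]; linarith
          exact_mod_cast this
        refine closeA (m - N) hnlt (Nat.sub_le m N) ?_ ?_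
        · push_cast [Nat.cast_sub hNm]; linarith
        · rw [show m - (m - N) = N by omega, hN]
    · -- y = N + ½ : b-odd with n = N
      have hNlt : N < 2 ^ (q - 1) := by
        have : (N : ℚ) < ((2 ^ (q - 1) : ℕ) : ℚ) := by rw [← hHq]; linarith
        exact_mod_cast this
      have hNm : N ≤ m := by
        have : (N : ℚ) ≤ m := by linarith
        exact_mod_cast this
      exact closeB N hNlt hNm (le_of_eq hN) (by push_cast [Nat.cast_sub hNm]; linarith)
    · -- both ≤ 2^(q-2) - ¼ : x + y ≤ σ - ½ ≤ m - ½ ; a-odd with n = ⌈x - ½⌉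
      have h22 : (2 : ℚ) ^ ((q : ℤ) - 2) + (2 : ℚ) ^ ((q : ℤ) - 2) = H := by
        rw [hHdef, ← two_mul, ← zpow_one_add₀ (two_ne_zero)]; congr 1; ring
      have hxy : x + y ≤ (m : ℚ) - 1 / 2 := by linarith
      set n := ⌈x - 1 / 2⌉₊ with hndef
      have hn1 : x - 1 / 2 ≤ n := Nat.le_ceil _
      have hn2 : (n : ℚ) < x - 1 / 2 + 1 := Nat.ceil_lt_add_one (by linarith)
      have hnlt : n < 2 ^ (q - 1) := by
        have : (n : ℚ) < ((2 ^ (q - 1) : ℕ) : ℚ) := by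
          rw [← hHq]; have : (0 : ℚ) < (2 : ℚ) ^ ((q : ℤ) - 2) := zpow_pos (by norm_num) _; linarith
        exact_mod_cast this
      have hnm : n ≤ m := by
        have : (n : ℚ) ≤ m := by linarith
        exact_mod_cast this
      exact closeA n hnlt hnm (by linarith) (by push_cast [Nat.cast_sub hnm]; linarith)

/-- **THE ROUTING CONJECTURE FOR EVERY SHAPE FROM (TT)** (`q ≥ 2`). -/
theorem routingBound_of_TT (hq : 2 ≤ q) (hTT : TT q) (s : Shape) : RoutingBound q s :=
  routingBound_of_LRL (le_trans (by norm_num) hq) (LRL_of_TT hq hTT) s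

/-- **CONJECTURE D FOR EVERY TREE FROM opt's TWO-TREE INEQUALITY (TT)**: for `q ≥ 2` with
`TT q`, every `p ≥ 1`, any nearest roundings into `F(q, emin)` and `F(p, emin)`, and every
summation tree of nonnegative `F(q, emin)` data: `s ≤ Q_t · fl_p(ŝ)`, `Q_t = treeQf u_q t u_p`. -/
theorem conjectureD_of_TT {p : ℕ} (hp : 1 ≤ p) (hq : 2 ≤ q) (hTT : TT q) {emin : ℤ}
    {fl flp : ℚ → ℚ} (hfl : IsRoundNearest q emin fl) (hflp : IsRoundNearest p emin flp)
    (t : SumTree) (ht : ∀ x ∈ leaves t, IsFloat q emin x ∧ 0 ≤ x) :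
    exact t ≤ treeQf (unitRoundoff q) t (unitRoundoff p) * flp (eval fl t) :=
  conjectureD_of_LRL hp (le_trans (by norm_num) hq) (LRL_of_TT hq hTT) hfl hflp t ht

end Raise

end Summit.Ventures.CertifiedArithmetic.LowPrec.Opt
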